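import Summits.Ventures.MM22.Rank333.Wang333TopCerts
import HarnessLib

/-!
# MM22 venture — every single-form row of `⟨3,3,3⟩/𝔽₂` is certified at `19`: `Cert 3 3 3 [κ] 19` for all `1 ≤ κ ≤ 511`

HONEST FRAMING (cell `pub-mm22`, seat LIT-2 g9; glue for the v4 (0′)/(0″) kernel routes, 0 kit). No new bound: these
are Wang's printed values (arXiv:2603.07280) for the three codimension-1 orbits (`[1]`, `[10]` at `19`; `[84]` at `20`,
used here at `19`), TRANSPORTED to each of the 511 nonzero forms by the sandwich witnesses that the landed top-layer data
already carries (`WangTop333Data.tab495`, the root DFS's lookup table: entry `k` = (mask `2^k`, orbit `j ∈ {17,18,19}`,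
`P, P⁻¹, Q, Q⁻¹`), validated in the tree as `Top333.tab495_ok : tableOK 3 3 os 20 [] c495 tab495 = true`, with the orbit
bounds now unconditional (`Top333.cert_top`, `Wang333TopCerts.lean`)).  Output: `cert_single κ : Cert 3 3 3 [κ] 19` —
the «singleton rows» input (`hsingle`, with `N − 1 = 19`) of `GF2Cert.Profile.cert_succ_of_noValidSet`
(`GF2ProfileSets.lean`): a 20-profile valid against all certified rows uses each form at most once (0/1 profiles).
-/

set_option Elab.async false

namespace Summit.Ventures.MM22.GF2Cert.Top333

open Summit.MatrixMultiplication.OmegaCensus.GF2RankLB Literature.Computability.AlgebraicComplexity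
open Summit.Ventures.MM22.GF2Cert Summit.Ventures.MM22

/-- Positional check of the root lookup table: entry `k` names exactly the single form `511 − k` (`= c495[k]`) and
points to an orbit certified at `≥ 19`. -/
def singleRowB (k : ℕ) : Bool :=
  (extraOf c495 (tab495.getD k (0, 0, 0, 0, 0, 0)).1 == [511 - k]) &&
    decide (19 ≤ bnd os (tab495.getD k (0, 0, 0, 0, 0, 0)).2.1)

/-- Positional check, chunk 0 (`[0·73, 0·73 + 73)`; `511 = 7 · 73`). -/
theorem singleRows_0 : allRange singleRowB (0 * 73) 73 = true := by
  decide +kernel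

/-- Positional check, chunk 1 (`[1·73, 1·73 + 73)`; `511 = 7 · 73`). -/
theorem singleRows_1 : allRange singleRowB (1 * 73) 73 = true := by
  decide +kernel

/-- Positional check, chunk 2 (`[2·73, 2·73 + 73)`; `511 = 7 · 73`). -/
theorem singleRows_2 : allRange singleRowB (2 * 73) 73 = true := by
  decide +kernel

/-- Positional check, chunk 3 (`[3·73, 3·73 + 73)`; `511 = 7 · 73`). -/
theorem singleRows_3 : allRange singleRowB (3 * 73) 73 = true := by
  decide +kernel

/-- Positional check, chunk 4 (`[4·73, 4·73 + 73)`; `511 = 7 · 73`). -/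
theorem singleRows_4 : allRange singleRowB (4 * 73) 73 = true := by
  decide +kernel

/-- Positional check, chunk 5 (`[5·73, 5·73 + 73)`; `511 = 7 · 73`). -/
theorem singleRows_5 : allRange singleRowB (5 * 73) 73 = true := by
  decide +kernel

/-- Positional check, chunk 6 (`[6·73, 6·73 + 73)`; `511 = 7 · 73`). -/
theorem singleRows_6 : allRange singleRowB (6 * 73) 73 = true := by
  decide +kernel

/-- All 511 entries pass the positional check. -/
theorem singleRows_ok : ∀ k < 7 * 73, singleRowB k = true := by
  refine forall_lt_of_chunks singleRowB 73 7 fun j hj => ?_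
  interval_cases j
  · exact singleRows_0
  · exact singleRows_1
  · exact singleRows_2
  · exact singleRows_3
  · exact singleRows_4
  · exact singleRows_5
  · exact singleRows_6

/-- The root lookup table has 511 entries. -/
theorem tab495_length : tab495.length = 511 := by
  decide +kernel

/-- Every entry of the root lookup table certifies its row: the sandwich (validated by `tab495_ok`) moves the
orbit's certificate (`cert_top`) to the constraint list `extraOf c495 mask`. -/
theorem cert_of_mem_tab495 {e : ℕ × ℕ × ℕ × ℕ × ℕ × ℕ} (he : e ∈ tab495) :
    Cert 3 3 3 ([] ++ extraOf c495 e.1) (bnd os e.2.1) := by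
  have h := tab495_ok
  rw [tableOK, List.all_eq_true] at h
  have hv := h e he
  simp only [Bool.and_eq_true, decide_eq_true_eq] at hv
  exact fun r β => le_of_sandB hv.2 (cert_top e.2.1 (by rw [os_length]; omega)) r β

/-- **Every nonzero form of `𝔽₂^{3×3}` is a certified single-form row at `19`**: for `1 ≤ κ ≤ 511`, every bilinear
computation of `⟨3,3,3⟩` over `𝔽₂` with the first factor constrained to `ker κ` has at least `19` products
(Wang 2026's codimension-1 orbit values, transported by the root table's sandwich witnesses). -/
theorem cert_single (κ : ℕ) (h1 : 1 ≤ κ) (h2 : κ ≤ 511) : Cert 3 3 3 [κ] 19 := by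
  have hk : 511 - κ < 511 := by omega
  have hrow := singleRows_ok (511 - κ) (by omega)
  simp only [singleRowB, Bool.and_eq_true, beq_iff_eq, decide_eq_true_eq] at hrow
  obtain ⟨hex, hb⟩ := hrow
  have hlt : 511 - κ < tab495.length := by rw [tab495_length]; exact hk
  have hmem : tab495.getD (511 - κ) (0, 0, 0, 0, 0, 0) ∈ tab495 := by
    rw [List.getD_eq_getElem _ _ hlt]
    exact List.getElem_mem hlt
  have hc := cert_of_mem_tab495 hmem
  rw [List.nil_append, hex, show 511 - (511 - κ) = κ by omega] at hc
  exact cert_mono hb hc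

/-- The same, indexed by the hypotheses of `GF2Cert.Profile.cert_succ_of_noValidSet` (`f ≠ 0`, `f < 2^(3·3)`,
bound `20 − 1`). -/
theorem cert_single' (f : ℕ) (h0 : f ≠ 0) (hf : f < 2 ^ (3 * 3)) : Cert 3 3 3 [f] (20 - 1) :=
  cert_single f (Nat.one_le_iff_ne_zero.2 h0) (by norm_num at hf; omega)

end Summit.Ventures.MM22.GF2Cert.Top333
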